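import Literature.NumberTheory.GaloisRepresentations.FrobeniusDensityTheorem
import Literature.NumberTheory.GaloisRepresentations.DegreeOnePrimesFixedField
import HarnessLib

/-!
# Degree-one primes of a fixed field with prescribed Frobenius, over a general base field

Topic `Literature/NumberTheory/GaloisRepresentations`; namespace
`Literature.NumberTheory.GaloisRepresentations.DegreeOnePrimesRel`.  Everything in this file is
PROVED (theorems only).  It is the relative version (base an arbitrary number field `M` instead
of `ℚ`, in the `Gal(L/M) = L ≃ₐ[M] L` / `IntermediateField` language of
`FrobeniusDensityTheorem.lean`) of the tree's `DegreeOnePrimesFrobenius.lean`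
(`DegreeOnePrimes.card_mul_card_frob_eq_card_conj_eq`, base `ℤ`), i.e. of the counting identity
behind Deuring's reduction of Chebotarev's density theorem to the cyclic case (M. Deuring, *Über
den Tschebotareffschen Dichtigkeitssatz*, Math. Ann. 110 (1935) 414–415; Lang, *Algebraic Number
Theory*, VIII §4 Thm. 10; Neukirch VII (13.4) p. 545, "Let `𝔓'` be the set of primes of `Σ` of
degree 1 over `K` with `𝔓 ∈ P(σ)` … to be verified via direct computation"):

* `inertiaDeg_mul_card_frob_eq` — for `L/M` Galois, `E` an intermediate field with
  `H = Gal(L/E)` commutative, `q` a prime of `M` unramified in `L`, and `h ∈ H`: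
  `f · #{Q ∣ q in L : Frob_Q = h} = #H · #{P' ∣ q in E : f(P'|q) = 1, Frob_Q = h ∀ Q ∣ P'}`
  (`f` the common residue degree of the primes of `L` above `q`; "`Frob_Q = h`" means: every
  arithmetic Frobenius of `L/M` at `Q` equals `h`);
* `orbit_eq_primesOver`, `smul_mem_primesOver` — the primes above `q` form one `Gal(L/M)`-orbit;
* `card_mul_card_frob_eq_card_conj_eq` — **`#H · #{P' ∣ q in E : f(P'|q) = 1, Frob = h above P'}
  = #{x ∈ Gal(L/M) : x F x⁻¹ = h}`** for any Frobenius `F` of `L/M` above `q`.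

Ingredients: the tree's `FrobeniusDensityTheorem.lean` ((a) a Frobenius in `Gal(L/E)` forces
`f(Q ∩ E | q) = 1`, `inertiaDeg_under_eq_one_of_mem_fixingSubgroup`; uniqueness of Frobenius at
unramified primes; trivial inertia), the orbit count
`DegreeOnePrimes.card_smul_eq_card_stabilizer_mul` of `DegreeOnePrimesFixedField.lean`, and
Mathlib's `Ideal.card_stabilizer_eq_card_inertia_mul_finrank`,
`Ideal.ncard_primesOver_mul_card_inertia_mul_finrank`, `Ideal.exists_smul_eq_of_isGaloisGroup`.
The `Gal(L/M)`-set of primes above `q` is realised as the orbit of one of them under the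
pointwise action on ideals (Mathlib equips the subtype `primesOver` with a second, `galRestrict`
based action of `L ≃ₐ[M] L`, which we avoid).

This is the push-down step of the density form of Chebotarev's crossing argument
(`ChebotarevCrossingGalois.lean`): densities of Frobenius fibres over the fixed field of an
auxiliary element `h` are transferred to the base.

## References

* M. Deuring, *Über den Tschebotareffschen Dichtigkeitssatz*, Math. Ann. 110 (1935), 414–415.
* S. Lang, *Algebraic Number Theory*, 2nd ed., GTM 110, Springer 1994, Ch. VIII §4, Thm. 10.
* J. Neukirch, *Algebraic Number Theory*, Springer 1999, VII (13.4), (13.6). [NeukirchANT1999]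
* D. A. Marcus, *Number Fields*, 2nd ed. (2018), Ch. 4, Thm. 28–29, 32, Ex. 11. [Marcus2018]
-/

noncomputable section

open NumberField IsDedekindDomain Ideal
open scoped Pointwise

namespace Literature.NumberTheory.GaloisRepresentations

namespace DegreeOnePrimesRel

variable {M L : Type*} [Field M] [NumberField M] [Field L] [NumberField L] [Algebra M L]
  [IsGalois M L]

variable (E : IntermediateField M L)

/-- **The refined fibrewise count, relative version.** Let `L/M` be Galois, `E` an
intermediate field with `H = Gal(L/E)` commutative, `q` a prime of `M` unramified in `L` (so all
primes `Q ∣ q` of `L` have the same residue degree `f`, Mathlib `Ideal.inertiaDeg_eq_of_isGaloisGroup`),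
and `h ∈ H`.  Then
`f · #{Q ∣ q : every Frobenius at Q equals h} = #H · #{P' ∣ q in E : f(P'|q) = 1 and every
Frobenius at every Q ∣ P' equals h}`:
count the pairs `(Q, P' = Q ∩ E)`; a prime `Q` with Frobenius `h ∈ H` lies over a degree-one
`P'` (`inertiaDeg_under_eq_one_of_mem_fixingSubgroup`), the condition descends to `P'` because the
primes above `P'` are `H`-conjugate (`Ideal.exists_smul_eq_of_isGaloisGroup` for `Gal(L/E)`) and
`H` is commutative, and a degree-one `P'` has exactly `#H / f` primes above it (trivial inertia,
`f(Q|P') = f`). [cite: NeukirchANT1999, VII (13.4) proof, p. 545] -/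
theorem inertiaDeg_mul_card_frob_eq [IsMulCommutative E.fixingSubgroup]
    {q : HeightOneSpectrum (𝓞 M)} (hunr : Algebra.IsUnramifiedIn (𝓞 L) q.asIdeal)
    {Q₀ : Ideal (𝓞 L)} (hQ₀ : Q₀ ∈ q.asIdeal.primesOver (𝓞 L))
    {h : L ≃ₐ[M] L} (hh : h ∈ E.fixingSubgroup) :
    Q₀.inertiaDeg (𝓞 M) *
        Nat.card {Q : q.asIdeal.primesOver (𝓞 L) //
          ∀ σ : L ≃ₐ[M] L, IsArithFrobAt (𝓞 M) σ Q.1 → σ = h} =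
      Nat.card E.fixingSubgroup *
        Nat.card {P' : q.asIdeal.primesOver (𝓞 E) // P'.1.inertiaDeg (𝓞 M) = 1 ∧
          ∀ Q : Ideal (𝓞 L), Q.IsPrime → Q.LiesOver P'.1 →
            ∀ σ : L ≃ₐ[M] L, IsArithFrobAt (𝓞 M) σ Q → σ = h} := by
  classical
  haveI : NumberField E := NumberField.of_module_finite M E
  set H : Subgroup (L ≃ₐ[M] L) := E.fixingSubgroup with hHdef
  -- `Gal(L/E)` as a Galois group for `𝓞 L / 𝓞 E`
  set eH : H ≃* (L ≃ₐ[E] L) := IntermediateField.fixingSubgroupEquiv E with heH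
  haveI : IsGaloisGroup (L ≃ₐ[E] L) (𝓞 E) (𝓞 L) := IsGaloisGroup.of_isFractionRing _ _ _ E L
  haveI : q.asIdeal.IsMaximal := q.isMaximal
  haveI := hQ₀.1
  haveI := hQ₀.2
  set f := Q₀.inertiaDeg (𝓞 M) with hfdef
  have hf : ∀ Q : q.asIdeal.primesOver (𝓞 L), Q.1.inertiaDeg (𝓞 M) = f := fun Q ↦ by
    haveI := Q.2.1; haveI := Q.2.2
    exact inertiaDeg_eq_of_isGaloisGroup q.asIdeal Q.1 Q₀ (L ≃ₐ[M] L)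
  -- the restriction map `u : Q ↦ Q ∩ 𝓞 E`
  let u : q.asIdeal.primesOver (𝓞 L) → q.asIdeal.primesOver (𝓞 E) := fun Q ↦
    ⟨Q.1.under (𝓞 E), under_intermediateField_mem_primesOver E Q.2⟩
  have hu : ∀ (Q : q.asIdeal.primesOver (𝓞 L)) (P' : q.asIdeal.primesOver (𝓞 E)),
      u Q = P' ↔ Q.1.LiesOver P'.1 := by
    intro Q P'
    rw [Subtype.ext_iff, liesOver_iff, eq_comm]
  -- size of a fibre of `u` over a degree-one prime
  have hfib : ∀ P' : q.asIdeal.primesOver (𝓞 E), P'.1.inertiaDeg (𝓞 M) = 1 →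
      f * Nat.card {Q : q.asIdeal.primesOver (𝓞 L) // Q.1.LiesOver P'.1} = Nat.card H := by
    intro P' hP'
    haveI := P'.2.1
    haveI := P'.2.2
    haveI : P'.1.IsMaximal := P'.2.1.isMaximal (Ideal.ne_bot_of_mem_primesOver q.ne_bot P'.2)
    obtain ⟨⟨Q, hQp, hQl⟩⟩ := (inferInstance : Nonempty (P'.1.primesOver (𝓞 L)))
    haveI : Q.LiesOver q.asIdeal := LiesOver.trans Q P'.1 q.asIdeal
    have hQ : Q ∈ q.asIdeal.primesOver (𝓞 L) := ⟨hQp, inferInstance⟩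
    -- inertia of `Q` in `Gal(L/E)` is trivial
    have hIG : Q.inertia (L ≃ₐ[M] L) = ⊥ := inertia_eq_bot_of_isUnramifiedIn hunr hQ
    have hIE : Q.inertia (L ≃ₐ[E] L) = ⊥ := by
      rw [eq_bot_iff]
      intro ψ hψ
      have : ψ.restrictScalars M ∈ Q.inertia (L ≃ₐ[M] L) := fun x ↦ hψ x
      rw [hIG, Subgroup.mem_bot] at this
      rw [Subgroup.mem_bot]
      exact AlgEquiv.restrictScalars_injective M (by rw [this]; rfl)
    have key := ncard_primesOver_mul_card_inertia_mul_finrank (G := L ≃ₐ[E] L) P'.1 Q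
    rw [hIE, Subgroup.card_bot, mul_one, ← Nat.card_coe_set_eq] at key
    -- `primesOver P' ≃ {Q ∈ primesOver q // LiesOver P'}`
    have hequiv : Nat.card (P'.1.primesOver (𝓞 L)) =
        Nat.card {Q : q.asIdeal.primesOver (𝓞 L) // Q.1.LiesOver P'.1} := by
      refine Nat.card_congr
        { toFun := fun Q ↦ ⟨⟨Q.1, Q.2.1, by
            haveI := Q.2.1; haveI := Q.2.2; exact LiesOver.trans Q.1 P'.1 q.asIdeal⟩, Q.2.2⟩
          invFun := fun Q ↦ ⟨Q.1.1, Q.1.2.1, Q.2⟩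
          left_inv := fun _ ↦ rfl
          right_inv := fun _ ↦ rfl }
    rw [hequiv] at key
    have hfQ : Q.inertiaDeg (𝓞 E) = f := by
      have t := inertiaDeg_tower (R := 𝓞 M) P'.1 Q
      rw [hP', one_mul] at t
      rw [← t]
      exact hf ⟨Q, hQ⟩
    rw [hfQ] at key
    -- `#Gal(L/E) = #H`
    have hcardH : Nat.card (L ≃ₐ[E] L) = Nat.card H := (Nat.card_congr eH.toEquiv).symm
    rw [hcardH] at key
    rw [mul_comm]
    exact key
  -- the predicates
  let c : q.asIdeal.primesOver (𝓞 L) → Prop := fun Q ↦ ∀ σ : L ≃ₐ[M] L, IsArithFrobAt (𝓞 M) σ Q.1 → σ = h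
  let c' : q.asIdeal.primesOver (𝓞 E) → Prop := fun P' ↦ P'.1.inertiaDeg (𝓞 M) = 1 ∧
    ∀ Q : Ideal (𝓞 L), Q.IsPrime → Q.LiesOver P'.1 → ∀ σ : L ≃ₐ[M] L, IsArithFrobAt (𝓞 M) σ Q → σ = h
  have hc : ∀ (Q : q.asIdeal.primesOver (𝓞 L)) (P' : q.asIdeal.primesOver (𝓞 E)),
      u Q = P' → (c Q ↔ c' P') := by
    intro Q P' hQP'
    haveI := Q.2.1
    haveI := Q.2.2
    haveI := P'.2.1
    haveI := P'.2.2
    haveI : Q.1.LiesOver P'.1 := (hu Q P').mp hQP'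
    constructor
    · intro hcQ
      -- a Frobenius at `Q` exists and equals `h ∈ H`, so `P'` has degree one
      have hQne : Q.1 ≠ ⊥ := Ideal.ne_bot_of_mem_primesOver q.ne_bot Q.2
      obtain ⟨σ₀, hσ₀⟩ := exists_isArithFrobAt_ringOfIntegers (M := M) Q.1 hQne
      have hσ₀h : σ₀ = h := hcQ σ₀ hσ₀
      have hdeg : P'.1.inertiaDeg (𝓞 M) = 1 := by
        have := inertiaDeg_under_eq_one_of_mem_fixingSubgroup E Q.2 hσ₀ (hσ₀h ▸ hh)
        rwa [← (show Q.1.under (𝓞 E) = P'.1 from Subtype.ext_iff.mp hQP')]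
      refine ⟨hdeg, fun Q' hQ' hQ'P' σ hσ ↦ ?_⟩
      -- `Q' = τ • Q` for some `τ ∈ Gal(L/E)`
      haveI := hQ'
      haveI := hQ'P'
      haveI : P'.1.IsMaximal := P'.2.1.isMaximal (Ideal.ne_bot_of_mem_primesOver q.ne_bot P'.2)
      obtain ⟨ψ, hψ⟩ := Ideal.exists_smul_eq_of_isGaloisGroup P'.1 Q.1 Q' (L ≃ₐ[E] L)
      set τ : L ≃ₐ[M] L := ψ.restrictScalars M with hτdef
      have hτH : τ ∈ H := by
        rw [hHdef, IntermediateField.mem_fixingSubgroup_iff]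
        intro x hx
        exact ψ.commutes ⟨x, hx⟩
      have hτQ : τ • Q.1 = Q' := by
        rw [← hψ]
        rfl
      have hστ : IsArithFrobAt (𝓞 M) (τ⁻¹ * σ * τ⁻¹⁻¹) (τ⁻¹ • Q') := hσ.conj τ⁻¹
      rw [← hτQ, inv_smul_smul, inv_inv] at hστ
      have h1 : τ⁻¹ * σ * τ = h := hcQ _ hστ
      have hcomm : τ * h = h * τ := by
        have := IsMulCommutative.is_comm.comm (⟨τ, hτH⟩ : H) ⟨h, hh⟩
        exact congrArg Subtype.val this
      calc σ = τ * (τ⁻¹ * σ * τ) * τ⁻¹ := by group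
        _ = τ * h * τ⁻¹ := by rw [h1]
        _ = h * τ * τ⁻¹ := by rw [hcomm]
        _ = h := by group
    · rintro ⟨-, hall⟩
      exact hall Q.1 Q.2.1 ((hu Q P').mp hQP')
  -- fibrewise count
  haveI : Fintype H := Fintype.ofFinite H
  haveI : Fintype (q.asIdeal.primesOver (𝓞 L)) := Fintype.ofFinite _
  haveI : Fintype (q.asIdeal.primesOver (𝓞 E)) := Fintype.ofFinite _
  rw [Nat.card_eq_fintype_card (α := {Q : q.asIdeal.primesOver (𝓞 L) // c Q}), Fintype.card_subtype,
    Finset.card_eq_sum_card_fiberwise (f := u) (t := (Finset.univ : Finset (q.asIdeal.primesOver (𝓞 E))))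
      (fun _ _ ↦ Finset.mem_coe.mpr (Finset.mem_univ _)),
    Finset.mul_sum, Nat.card_eq_fintype_card (α := {P' : q.asIdeal.primesOver (𝓞 E) // c' P'}),
    Fintype.card_subtype, Finset.card_eq_sum_ones, Finset.mul_sum, Finset.sum_filter]
  refine Finset.sum_congr rfl fun P' _ ↦ ?_
  by_cases hP' : c' P'
  · rw [if_pos hP', mul_one, ← hfib P' hP'.1, Finset.filter_filter]
    congr 1
    rw [Nat.card_eq_fintype_card, Fintype.card_subtype]
    refine congrArg Finset.card (Finset.filter_congr fun Q _ ↦ ?_)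
    rw [← hu Q P']
    exact ⟨fun hQ ↦ hQ.2, fun hQ ↦ ⟨(hc Q P' hQ).mpr hP', hQ⟩⟩
  · rw [if_neg hP', Finset.filter_filter]
    have : (Finset.univ.filter fun Q : q.asIdeal.primesOver (𝓞 L) ↦ c Q ∧ u Q = P') = ∅ :=
      Finset.filter_eq_empty_iff.mpr fun Q _ hQ ↦ hP' ((hc Q P' hQ.2).mp hQ.1)
    rw [this, Finset.card_empty, mul_zero]

/-- Translates `x • Q` (`x ∈ Gal(L/M)`, pointwise action on ideals of `𝓞 L`) of a prime above `q`
are primes above `q`. [folklore] -/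
theorem smul_mem_primesOver {q : HeightOneSpectrum (𝓞 M)} {Q : Ideal (𝓞 L)}
    (hQ : Q ∈ q.asIdeal.primesOver (𝓞 L)) (x : L ≃ₐ[M] L) : x • Q ∈ q.asIdeal.primesOver (𝓞 L) := by
  haveI : IsGaloisGroup (L ≃ₐ[M] L) (𝓞 M) (𝓞 L) := IsGaloisGroup.of_isFractionRing _ _ _ M L
  haveI := hQ.1
  haveI := hQ.2
  exact ⟨inferInstance, inferInstance⟩

/-- **The primes above `q` form a single `Gal(L/M)`-orbit** (pointwise action on ideals;
transitivity is Mathlib's `Ideal.exists_smul_eq_of_isGaloisGroup`). [folklore] -/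
theorem orbit_eq_primesOver {q : HeightOneSpectrum (𝓞 M)} {Q₀ : Ideal (𝓞 L)}
    (hQ₀ : Q₀ ∈ q.asIdeal.primesOver (𝓞 L)) :
    MulAction.orbit (L ≃ₐ[M] L) Q₀ = q.asIdeal.primesOver (𝓞 L) := by
  haveI : IsGaloisGroup (L ≃ₐ[M] L) (𝓞 M) (𝓞 L) := IsGaloisGroup.of_isFractionRing _ _ _ M L
  haveI : q.asIdeal.IsMaximal := q.isMaximal
  haveI := hQ₀.1
  haveI := hQ₀.2
  ext Q
  constructor
  · rintro ⟨x, rfl⟩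
    exact smul_mem_primesOver hQ₀ x
  · intro hQ
    haveI := hQ.1
    haveI := hQ.2
    obtain ⟨σ, hσ⟩ := Ideal.exists_smul_eq_of_isGaloisGroup q.asIdeal Q₀ Q (L ≃ₐ[M] L)
    exact ⟨σ, hσ⟩

/-- **The refined Deuring count, relative version.** Let `L/M` be Galois, `E` an intermediate
field with `H = Gal(L/E)` commutative, `q` a prime of `M` unramified in `L`, `F` an arithmetic
Frobenius of `L/M` at some `Q₀ ∣ q`, and `h ∈ H`.  Then
`#H · #{P' ∣ q prime of E : f(P'|q) = 1 and every Frobenius at every Q ∣ P' equals h}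
 = #{x ∈ Gal(L/M) : x F x⁻¹ = h}`.
Proof: `x ↦ x • Q₀` identifies `{x : x F x⁻¹ = h}` with the pairs (`x`, prime `x • Q₀` whose
unique Frobenius is `h`); counting along the transitive action with stabilisers of order `f`
(`DegreeOnePrimes.card_smul_eq_card_stabilizer_mul`, Mathlib
`Ideal.card_stabilizer_eq_card_inertia_mul_finrank`, trivial inertia) and then fibrewise over `E`
(`inertiaDeg_mul_card_frob_eq`) gives the identity.  Summing over `h ∈ H` recovers Neukirch's
(13.4)/Lang VIII §4 Thm. 10.  For `h = x F x⁻¹` the right side is the centraliser order `#C(F)`.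
[cite: NeukirchANT1999, VII (13.4), (13.6)] -/
theorem card_mul_card_frob_eq_card_conj_eq [IsMulCommutative E.fixingSubgroup]
    {q : HeightOneSpectrum (𝓞 M)} (hunr : Algebra.IsUnramifiedIn (𝓞 L) q.asIdeal)
    {Q₀ : Ideal (𝓞 L)} (hQ₀ : Q₀ ∈ q.asIdeal.primesOver (𝓞 L))
    {F : L ≃ₐ[M] L} (hF : IsArithFrobAt (𝓞 M) F Q₀) {h : L ≃ₐ[M] L} (hh : h ∈ E.fixingSubgroup) :
    Nat.card E.fixingSubgroup *
        Nat.card {P' : q.asIdeal.primesOver (𝓞 E) // P'.1.inertiaDeg (𝓞 M) = 1 ∧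
          ∀ Q : Ideal (𝓞 L), Q.IsPrime → Q.LiesOver P'.1 →
            ∀ σ : L ≃ₐ[M] L, IsArithFrobAt (𝓞 M) σ Q → σ = h} =
      Nat.card {x : L ≃ₐ[M] L // x * F * x⁻¹ = h} := by
  classical
  haveI : IsGaloisGroup (L ≃ₐ[M] L) (𝓞 M) (𝓞 L) := IsGaloisGroup.of_isFractionRing _ _ _ M L
  haveI : q.asIdeal.IsMaximal := q.isMaximal
  haveI := hQ₀.1
  haveI := hQ₀.2
  -- the transitive `Gal(L/M)`-set of primes above `q`, realised as the orbit of `Q₀`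
  have hX : MulAction.orbit (L ≃ₐ[M] L) Q₀ = q.asIdeal.primesOver (𝓞 L) := orbit_eq_primesOver hQ₀
  haveI : Finite (MulAction.orbit (L ≃ₐ[M] L) Q₀) := by rw [hX]; infer_instance
  let P₀ : MulAction.orbit (L ≃ₐ[M] L) Q₀ := ⟨Q₀, MulAction.mem_orbit_self Q₀⟩
  let c : MulAction.orbit (L ≃ₐ[M] L) Q₀ → Prop := fun Q ↦
    ∀ σ : L ≃ₐ[M] L, IsArithFrobAt (𝓞 M) σ Q.1 → σ = h
  -- Step 1: `x F x⁻¹` is *the* Frobenius of `x • Q₀`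
  have h1 : Nat.card {x : L ≃ₐ[M] L // x * F * x⁻¹ = h} =
      Nat.card {x : L ≃ₐ[M] L // c (x • P₀)} := by
    refine Nat.card_congr (Equiv.subtypeEquivRight fun x ↦ ?_)
    have hFx : IsArithFrobAt (𝓞 M) (x * F * x⁻¹) (x • Q₀) := hF.conj x
    have hmem : x • Q₀ ∈ q.asIdeal.primesOver (𝓞 L) := smul_mem_primesOver hQ₀ x
    change _ ↔ ∀ σ : L ≃ₐ[M] L, IsArithFrobAt (𝓞 M) σ (x • Q₀) → σ = h
    constructor
    · intro hx σ hσ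
      rw [eq_of_isArithFrobAt_of_isUnramifiedIn hunr hmem hσ hFx, hx]
    · intro hcx
      exact hcx _ hFx
  -- Step 2: count along the transitive action
  have h2 := DegreeOnePrimes.card_smul_eq_card_stabilizer_mul (G := L ≃ₐ[M] L) c P₀
  -- Step 3: `#Stab(Q₀) = f(Q₀/q)` (trivial inertia)
  have h3 : Nat.card (MulAction.stabilizer (L ≃ₐ[M] L) P₀) = Q₀.inertiaDeg (𝓞 M) := by
    have e : MulAction.stabilizer (L ≃ₐ[M] L) P₀ = MulAction.stabilizer (L ≃ₐ[M] L) Q₀ := by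
      ext x
      simp only [MulAction.mem_stabilizer_iff, Subtype.ext_iff]
      exact Iff.rfl
    rw [e, card_stabilizer_eq_card_inertia_mul_finrank q.asIdeal Q₀,
      inertia_eq_bot_of_isUnramifiedIn hunr hQ₀, Subgroup.card_bot, one_mul]
  -- Step 4: the refined fibrewise count, transported along `X = primesOver q`
  have h4 := inertiaDeg_mul_card_frob_eq E hunr hQ₀ hh
  have h5 : Nat.card {y : MulAction.orbit (L ≃ₐ[M] L) Q₀ // c y} =
      Nat.card {Q : q.asIdeal.primesOver (𝓞 L) //
        ∀ σ : L ≃ₐ[M] L, IsArithFrobAt (𝓞 M) σ Q.1 → σ = h} :=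
    Nat.card_congr ((Equiv.setCongr hX).subtypeEquiv fun _ ↦ Iff.rfl)
  rw [h1, h2, h3, h5, ← h4]

end DegreeOnePrimesRel

end Literature.NumberTheory.GaloisRepresentations
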